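import Summits.BirchSwinnertonDyer.Rank1Residual.X12.O11.RamifiedEllipticUnitMechanismZp
import Summits.BirchSwinnertonDyer.Rank1Residual.X12.O11.RamifiedRubinFormulaLine
import HarnessLib

/-!
# O11 (CM, analytic rank one, the RAMIFIED prime `p = |d_K| ≥ 5`): the RUBIN-FORMULA LINE over the
# CORRECTED carrier `𝒪_𝔭 · z(𝟙)` — stubs `S_dict′` (`m_loc = n + n'` ∧ (inj)), `S_sat`
# (`S_{p,rel}(E/K) ≤ E(K) ⊗ ℤ_p`), `S_B4′` (`λ₀ = c + m_loc`, PROVED Theorems-side), `S_open` (the analytic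
# ramified Rubin formula, OPEN) — and the PROVED composition to `RamifiedCMBottomClassIndexLawAtZp W p`
# (cell `bsd-cm`, planner D117 (3) + addendum (A2), line card `Lines/rubin-formula-zp.md`; seat
# `bsd-cm-k7r-c4` g5; NOTHING asserted)

HONEST FRAMING. `…Zp` twin of `RamifiedRubinFormulaLine.lean` (k7r-c3 g5). The carrier audit (cell memo
MEMO-k7r-c4-g5-CARRIER, D117) showed that the old line's `S_B4`/`S_open` and the crux they compose to are
VACUOUS over the ℤ-span carrier `endSpan`; over the `p`-adic span (`PadicEndSpan.lean`) the same line is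
meaningful, and the audit's layer 2 (k7r-c2 SB4-RECUT, memo §5) named the two arithmetic inputs the index
split silently needs. This file types the repaired line, fact-free `Prop`s with bodies, nothing asserted:

* `S_dict′` = `RamifiedCMLocalMordellWeilDictAtZp W p` — INTRINSIC: at every analytic-rank-one O11 frame
  with its Mordell–Weil data, `m_loc = n + n'` (the old `S_dict`, carrier-independent) AND (inj) `loc_𝔭` is
  injective on `E(K) ⊗ ℤ_p` modulo torsion (the same `±`-decomposition; line card, k7r-c3's hand).
* `S_sat` = `RamifiedCMBottomSaturationAt W p` — INTRINSIC: at every such frame, whenever the local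
  Mordell–Weil index is finite (`hm`), `S_{p,rel}(E/K) ≤ E(K) ⊗ ℤ_p` in compact currency. CONTENT: «`Sel_rel =
  Sel_f` at the bottom» (`S_rel/S_f` torsion-free — kernel, k7r-c2; finite — Poitou–Tate PAPER-S, or the
  GZK-free algebraic route via `hc`, line card) ∧ «`T_pШ(E/K) = 0`» (GZK). Its registered stub carries the
  published antecedent `rank_eq_analyticRank_of_analyticRank_le_one` (pattern `StrictTorsionSevenOfGZK`);
  the `Prop` itself is fact-free.
* `S_B4′` = `RamifiedCMBottomLocalIndexSplitAtZp W p` — RELATIVE, shared `(D, c)`: `hcZp → (sat) → (inj) →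
  hm → λ₀(D) = c + m`. PROVED for every `W`, `p` Theorems-side
  (`…Theorems.RamifiedSevenEllipticUnits.BottomLocalIndexSplit.hasLocalBottomIndexExpZp_of_sat_of_inj`,
  p465731); typed here so that the skeleton can name it.
* `S_open` = `RamifiedCMRubinFormulaAtZp W p` — RELATIVE, shared `(D, c)`, PINNED datum (`Ω ≠ 0`,
  `L(φ,s) = L(W,s)`), under the IMC identity: every `λ₀(D)` equals `2(n + n') + ord_p q + ord_p q'` — the
  analytic ramified Rubin formula (★_an)♯ ([BKNO] Thm. 7.2 at `χ = 𝟙` + unit bottom period; §1.4 «report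
  elsewhere»). THE OPEN STUB; NOT in print.
* `ramifiedCMBottomClassIndexLawAtZp_of_dictZp_of_sat_of_splitZp_of_rubinFormulaZp` — PROVED (linear
  arithmetic): `S_dict′ → S_sat → S_B4′ → S_open → RamifiedCMBottomClassIndexLawAtZp W p`.
* `S_sat-Zp` = `RamifiedCMBottomSaturationAtZp W p` (RESHAPE of `S_sat`, seat k7r-c4 g6 on k7r-c2 g5's
  request) — the same conclusion RELATIVE to the pinned datum: binders = the whole context of the value
  law (`hcZp`, pin, frame data, IMC identity) + `m` + (inj); with `hcZp` the rank half is subgroup algebra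
  (k7r-c2's `RelaxedEqCompact`), leaving `z(𝟙) ∈ S_p(E/K)` (Lemma 7.1 at `𝟙` via the pin) and `T_pШ = 0`;
  `ramifiedCMBottomSaturationAtZp_of_saturationAt` (intrinsic ⇒ relative) and the re-threaded composition
  `ramifiedCMBottomClassIndexLawAtZp_of_dictZp_of_satZp_of_splitZp_of_rubinFormulaZp` — PROVED.

References: [BKNO] arXiv:2608.06879 (2026) §1.4, Thm. 1.8, §3.3.1, Def. 4.7, Lemma 7.1, Thm. 7.2
[BurungaleKobayashiNakamuraOta2026]; B. Perrin-Riou, Bull. SMF 115 (1987) §0; Ann. Inst. Fourier 43 (1993)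
§3.3; cell memos MEMO-k7r-c4-g5-CARRIER.md §5, SB4-RECUT.md, DESCENT-ANATOMY-ram-g8.md, Lines/rubin-formula-zp.md.
-/

noncomputable section

open scoped Classical

open WeierstrassCurve NumberField IsDedekindDomain Field PowerSeries
  Literature.NumberTheory.EllipticCurves
  Literature.NumberTheory.EllipticCurves.Rank1Residual
  Literature.NumberTheory.EllipticCurves.Rank1Residual.Typed
  Literature.NumberTheory.EllipticCurves.Castella2018
  Literature.NumberTheory.EllipticCurves.BurungaleKobayashiNakamuraOta2026
  Literature.NumberTheory.GaloisRepresentations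
  Summit.BirchSwinnertonDyer.Rank1Residual.Additive

namespace Summit.BirchSwinnertonDyer.Rank1Residual.X12.O11

variable (W : WeierstrassCurve ℚ) [W.IsElliptic] [W.IsGloballyMinimal] (p : ℕ) [Fact p.Prime]

section RubinFormulaLineZp

/-- **S_dict′ — the LOCAL MORDELL–WEIL DICTIONARY at the ramified prime WITH non-degeneracy (typed input;
nothing asserted): `m_loc = n + n'` ∧ (inj).** At every analytic-rank-one O11 frame `(K, 𝔭, W', C)` and every
anticyclotomic `ℤ_p`-tower `κ`, with the frame data (`P`, `P'` generators modulo torsion, no `p`-torsion in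
`E(ℚ_p)`, `E'(ℚ_p)`, exact levels `n`, `n'`): (a) `HasBottomLocalMordellWeilIndexExp W p K 𝔭 κ (n + n')` (the
old `S_dict`), AND (b) `loc_𝔭` is injective on `E(K) ⊗ ℤ_p` modulo torsion: a Mordell–Weil Kummer class whose
localisation at `𝔭` is torsion is torsion. Both come from the `±`-decomposition
`E(K) ⊗ ℤ_p = ℤ_p P ⊕ ℤ_p P'`, `E(K_𝔭) ⊗ ℤ_p ⊇ E(ℚ_p) ⊗ ℤ_p ⊕ E'(ℚ_p) ⊗ ℤ_p` (cell derivation; k7r-c3's plan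
L3–L6). INTRINSIC (no datum); NOT a published statement. [cite: BurungaleKobayashiNakamuraOta2026, Thm. 1.8 and §1.4 (arXiv:2608.06879 pp. 7–8) (the objects; claim; preprint; shape only)]
[cite: SilvermanAEC2009, Exercise 10.16 (quadratic descent of the Mordell–Weil group)] -/
@[conjecture] def RamifiedCMLocalMordellWeilDictAtZp : Prop :=
  ∀ (K : Type) [Field K] [NumberField K] (𝔭 : HeightOneSpectrum (𝓞 K))
    (W' : WeierstrassCurve ℚ) [W'.IsElliptic] [W'.IsGloballyMinimal] (C : VariableChange ℚ),
    IsFrame W p K 𝔭 W' C → W.analyticRank = 1 →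
    ∀ (κ : ZpExtension K p), κ.IsAnticyclotomic →
      ∀ (P : W.toAffine.Point) (n : ℕ) (P' : W'.toAffine.Point) (n' : ℕ),
        ¬ IsOfFinAddOrder P →
        (∀ R : W.toAffine.Point, ∃ (k : ℤ) (T : W.toAffine.Point), IsOfFinAddOrder T ∧ R = k • P + T) →
        (∀ Q : (W.baseChange ℚ_[p]).toAffine.Point, p • Q = 0 → Q = 0) →
        (∃ Q : (W.baseChange ℚ_[p]).toAffine.Point, p ^ n • Q = W.toPadicPoint p P) →
        (∀ Q : (W.baseChange ℚ_[p]).toAffine.Point, p ^ (n + 1) • Q ≠ W.toPadicPoint p P) →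
        ¬ IsOfFinAddOrder P' →
        (∀ R : W'.toAffine.Point, ∃ (k : ℤ) (T : W'.toAffine.Point),
          IsOfFinAddOrder T ∧ R = k • P' + T) →
        (∀ Q : (W'.baseChange ℚ_[p]).toAffine.Point, p • Q = 0 → Q = 0) →
        (∃ Q : (W'.baseChange ℚ_[p]).toAffine.Point, p ^ n' • Q = W'.toPadicPoint p P') →
        (∀ Q : (W'.baseChange ℚ_[p]).toAffine.Point, p ^ (n' + 1) • Q ≠ W'.toPadicPoint p P') →
        HasBottomLocalMordellWeilIndexExp W p K 𝔭 κ (n + n') ∧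
        ∀ x ∈ (W.baseChange K).mordellWeilKummerSpan p (κ.layerSubgroup 0),
          (W.baseChange K).localTorsionResPi (closureEmb (K := K) (𝔭.adicCompletion K)) p
              (κ.layerSubgroup 0) x ∈
            AddCommGroup.torsion (((W.baseChange K).baseChange (𝔭.adicCompletion K)).torsionH1Pi p
              (localSubgroupOfEmb (κ.layerSubgroup 0) (closureEmb (K := K) (𝔭.adicCompletion K)))) →
          x ∈ AddCommGroup.torsion ((W.baseChange K).torsionH1Pi p (κ.layerSubgroup 0))

/-- **S_sat — BOTTOM SATURATION (typed input; nothing asserted): `S_{p,rel}(E/K) ≤ E(K) ⊗ ℤ_p`.** At every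
analytic-rank-one O11 frame and anticyclotomic tower, whenever the local Mordell–Weil index at `𝔭` is finite
(`HasBottomLocalMordellWeilIndexExp W p K 𝔭 κ m`), every element of the bottom relaxed compact Selmer group is a
Mordell–Weil Kummer class: `relaxedCompactSelmerOver (κ.layerSubgroup 0) p {𝔭} ≤ mordellWeilKummerSpan p
(κ.layerSubgroup 0)`. CONTENT (line card): `S_rel/S_f` is torsion-free (kernel, k7r-c2) and of finite index
(Poitou–Tate: `coker(Sel_f(K, E[p^∞]) → E(K_𝔭) ⊗ ℚ_p/ℤ_p) = 0` under `hm` — global duality, not in the tree;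
or the GZK-free algebraic route through a finite bottom index exponent, `rank_ℤ End_K(E) ≤ 2` and Mattuck),
and `S_f ≤ E(K) ⊗ ℤ_p` (`T_pШ(E/K) = 0`: finiteness of `Ш(E/ℚ)[p^∞]`, `Ш(E'/ℚ)[p^∞]` — the GZK conjunct
`rank_eq_analyticRank_of_analyticRank_le_one`, which the REGISTERED stub takes as antecedent — plus the
`p`-saturation of the Kummer span among compatible Selmer families). INTRINSIC; fact-free as a `Prop`.
[cite: PerrinRiou1987BSMF, §0 pp. 401–402 (the descent sequence `0 → E(L) ⊗ ℤ_p → S_p(L) → T_pШ → 0`)]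
[cite: BurungaleKobayashiNakamuraOta2026, §3.1.2 and Lemma 7.1 (arXiv:2608.06879 pp. 16, 40) (claim; preprint; shape only)] -/
@[conjecture] def RamifiedCMBottomSaturationAt : Prop :=
  ∀ (K : Type) [Field K] [NumberField K] (𝔭 : HeightOneSpectrum (𝓞 K))
    (W' : WeierstrassCurve ℚ) [W'.IsElliptic] [W'.IsGloballyMinimal] (C : VariableChange ℚ),
    IsFrame W p K 𝔭 W' C → W.analyticRank = 1 →
    ∀ (κ : ZpExtension K p), κ.IsAnticyclotomic →
      ∀ (m : ℕ), HasBottomLocalMordellWeilIndexExp W p K 𝔭 κ m →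
        (W.baseChange K).relaxedCompactSelmerOver (κ.layerSubgroup 0) p {𝔭} ≤
          (W.baseChange K).mordellWeilKummerSpan p (κ.layerSubgroup 0)

/-- **S_B4′ — THE BOTTOM INDEX SPLITS INTO GLOBAL × LOCAL over the corrected carrier (typed; PROVED
Theorems-side for every `W`, `p`): `λ₀(D) = c + m_loc`.** At every analytic-rank-one O11 frame and
anticyclotomic tower with generator, for every datum `D` with bottom index exponent `c` over `𝒪_𝔭 · z(𝟙)`
(`D.HasBottomIndexExpZp c`), GIVEN (sat) and (inj) (the conclusions of `S_sat`, `S_dict′`), every local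
Mordell–Weil exponent `m` gives `D.HasLocalBottomIndexExpZp (c + m)`. Pure index algebra (seat k7r-c4's
`hasLocalBottomIndexExpZp_of_sat_of_inj`, p465731); typed here so that the skeleton of `rubin-formula-zp` can
name it — its registered stub closes at once. [cite: BurungaleKobayashiNakamuraOta2026, Lemma 7.1, Thm. 7.2 and §1.4 (arXiv:2608.06879 pp. 8, 40–41) (claim; preprint; shape only)]
[cite: PerrinRiou1987BSMF, §0 pp. 401–402 (the descent sequence)] -/
@[conjecture] def RamifiedCMBottomLocalIndexSplitAtZp : Prop :=
  ∀ (K : Type) [Field K] [NumberField K] (𝔭 : HeightOneSpectrum (𝓞 K))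
    (W' : WeierstrassCurve ℚ) [W'.IsElliptic] [W'.IsGloballyMinimal] (C : VariableChange ℚ),
    IsFrame W p K 𝔭 W' C → W.analyticRank = 1 →
    ∀ (κ : ZpExtension K p), κ.IsAnticyclotomic →
      ∀ (γ : absoluteGaloisGroup K) [Fact (κ.IsTopGenerator γ)]
        (ι : PadicAlgCl p ≃+* ℂ) (φ : HeckeCharacter K) (Ω : ℂ) (𝓔 : AcDualExpSystem W p K 𝔭 κ ι)
        (D : EllipticUnitClassData W p K 𝔭 κ γ ι φ Ω 𝓔) (c : ℕ), D.HasBottomIndexExpZp c →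
        (W.baseChange K).relaxedCompactSelmerOver (κ.layerSubgroup 0) p {𝔭} ≤
          (W.baseChange K).mordellWeilKummerSpan p (κ.layerSubgroup 0) →
        (∀ x ∈ (W.baseChange K).mordellWeilKummerSpan p (κ.layerSubgroup 0),
          (W.baseChange K).localTorsionResPi (closureEmb (K := K) (𝔭.adicCompletion K)) p
              (κ.layerSubgroup 0) x ∈
            AddCommGroup.torsion (((W.baseChange K).baseChange (𝔭.adicCompletion K)).torsionH1Pi p
              (localSubgroupOfEmb (κ.layerSubgroup 0) (closureEmb (K := K) (𝔭.adicCompletion K)))) →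
          x ∈ AddCommGroup.torsion ((W.baseChange K).torsionH1Pi p (κ.layerSubgroup 0))) →
        ∀ (m : ℕ), HasBottomLocalMordellWeilIndexExp W p K 𝔭 κ m → D.HasLocalBottomIndexExpZp (c + m)

/-- **S_open — THE ANALYTIC RAMIFIED RUBIN FORMULA in valuation form over the corrected carrier (typed
input, RELATIVE, shared `(D, c)`, PINNED datum, under the IMC identity; THE OPEN STUB; nothing asserted):
`λ₀(D) = 2(n + n') + ord_p #Ш_an(W) + ord_p #Ш_an(W')`.** At every analytic-rank-one O11 frame with its data and
every pinned datum `D` (`Ω ≠ 0`, `L(φ,s) = L(W,s)` on `re s > 3/2`) with exponent `c` over `𝒪_𝔭 · z(𝟙)`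
satisfying the main-conjecture identity: every local bottom index exponent `λ₀` (`D.HasLocalBottomIndexExpZp λ₀`)
equals `2(n + n') + ord_p q + ord_p q'` (`q = #Ш_an(W)`, `q' = #Ш_an(W')`). READING: [BKNO] Thm. 7.2 at `χ = 𝟙`,
`ℒ_{p,v_ε}(φ)(𝟙) = exp*_ω(v_{−ε}(𝟙)) · log_ω(loc_𝔭 z(𝟙))`, with the unit bottom period (`ν₀ = 0`), makes
`λ₀ = ord_π ℒ_{p,v_ε}(φ)(𝟙)` — so this is the `p`-adic BSD-type formula for [BKNO]'s integral `ℒ` at `χ = 𝟙`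
(seat ram g8: ⟺ (★) `ord_π ℒ(𝟙) = 2 m_loc + ord_p(#Ш_an #Ш_an')`); [BKNO] §1.4 defers exactly this. Junk data
(`scaleByP`: `λ₀ ↦ λ₀ + 2`, `c ↦ c + 2`) fail the IMC identity. CONSTRUCTION / OPEN; NOT in print. Twin of
`RamifiedCMRubinFormulaAt` (ℤ-span carrier, vacuous). [cite: BurungaleKobayashiNakamuraOta2026, Thm. 7.2, Def. 4.7 and §1.4 (arXiv:2608.06879 pp. 8, 27, 41) (claim; preprint; shape only)]
[cite: GrossZagier1986, Thm. I.(7.3) (rationality of #Ш_an)] -/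
@[conjecture] def RamifiedCMRubinFormulaAtZp : Prop :=
  ∀ (K : Type) [Field K] [NumberField K] (𝔭 : HeightOneSpectrum (𝓞 K))
    (W' : WeierstrassCurve ℚ) [W'.IsElliptic] [W'.IsGloballyMinimal] (C : VariableChange ℚ),
    IsFrame W p K 𝔭 W' C → W.analyticRank = 1 →
    ∀ (κ : ZpExtension K p), κ.IsAnticyclotomic →
      ∀ (γ : absoluteGaloisGroup K) [Fact (κ.IsTopGenerator γ)]
        (P : W.toAffine.Point) (n : ℕ) (P' : W'.toAffine.Point) (n' : ℕ),
        ¬ IsOfFinAddOrder P →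
        (∀ R : W.toAffine.Point, ∃ (k : ℤ) (T : W.toAffine.Point), IsOfFinAddOrder T ∧ R = k • P + T) →
        (∀ Q : (W.baseChange ℚ_[p]).toAffine.Point, p • Q = 0 → Q = 0) →
        (∃ Q : (W.baseChange ℚ_[p]).toAffine.Point, p ^ n • Q = W.toPadicPoint p P) →
        (∀ Q : (W.baseChange ℚ_[p]).toAffine.Point, p ^ (n + 1) • Q ≠ W.toPadicPoint p P) →
        ¬ IsOfFinAddOrder P' →
        (∀ R : W'.toAffine.Point, ∃ (k : ℤ) (T : W'.toAffine.Point),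
          IsOfFinAddOrder T ∧ R = k • P' + T) →
        (∀ Q : (W'.baseChange ℚ_[p]).toAffine.Point, p • Q = 0 → Q = 0) →
        (∃ Q : (W'.baseChange ℚ_[p]).toAffine.Point, p ^ n' • Q = W'.toPadicPoint p P') →
        (∀ Q : (W'.baseChange ℚ_[p]).toAffine.Point, p ^ (n' + 1) • Q ≠ W'.toPadicPoint p P') →
        ∀ (q q' : ℚ), shaAn W = (q : ℂ) → shaAn W' = (q' : ℂ) →
        ∀ (ι : PadicAlgCl p ≃+* ℂ) (φ : HeckeCharacter K) (Ω : ℂ) (𝓔 : AcDualExpSystem W p K 𝔭 κ ι)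
          (D : EllipticUnitClassData W p K 𝔭 κ γ ι φ Ω 𝓔) (c : ℕ),
          Ω ≠ 0 → (∀ s : ℂ, 3 / 2 < s.re → heckeLFunction φ s = W.LSeries s) →
          D.HasBottomIndexExpZp c →
          (∀ (n₀ : ℕ), AcSelmer.XAc.HasCharValuationAt (W.baseChange K) p κ 𝔭 ∅ γ n₀ →
            Finite {x : AcSelmer.XAc (W.baseChange K) p κ 𝔭 ∅ γ //
              (PowerSeries.X : IwasawaAlgebra p) • x = 0} →
            (n₀ : ℤ) + padicValNat p (Nat.card {x : AcSelmer.XAc (W.baseChange K) p κ 𝔭 ∅ γ //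
                (PowerSeries.X : IwasawaAlgebra p) • x = 0}) = c) →
          ∀ (l : ℕ), D.HasLocalBottomIndexExpZp l →
            (l : ℤ) = 2 * ((n : ℤ) + n') + padicValRat p q + padicValRat p q'

variable {W p}

omit [W.IsGloballyMinimal] in
/-- **THE COMPOSITION OF THE REPAIRED LINE (PROVED): `S_dict′ → S_sat → S_B4′ → S_open → (R-PR)|IMC-Zp`.**
Given the pinned datum `D` with exponent `c` over `𝒪_𝔭 · z(𝟙)` and its IMC identity at an analytic-rank-one
frame: `S_dict′` gives `m_loc = n + n'` and (inj), `S_sat` (fed with that `m_loc`) gives (sat), `S_B4′` gives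
`λ₀(D) = c + (n + n')`, `S_open` gives `λ₀(D) = 2(n + n') + ord_p q + ord_p q'`; hence `c = n + n' + ord_p q +
ord_p q'`, the value law `RamifiedCMBottomClassIndexLawAtZp W p`. Linear arithmetic; the skeleton
`EllipticUnitValueSevenOfGZK_of` of `Lines/rubin-formula-zp.lean` (planner D117 (3)). [cite: Miller2011LMS, Def. 1.1] -/
theorem ramifiedCMBottomClassIndexLawAtZp_of_dictZp_of_sat_of_splitZp_of_rubinFormulaZp
    (hdict : RamifiedCMLocalMordellWeilDictAtZp W p) (hsat : RamifiedCMBottomSaturationAt W p)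
    (hsplit : RamifiedCMBottomLocalIndexSplitAtZp W p) (hopen : RamifiedCMRubinFormulaAtZp W p) :
    RamifiedCMBottomClassIndexLawAtZp W p := by
  intro K _ _ 𝔭 W' _ _ C hF hr κ hκ γ _ P n P' n' hP hgen htors hdiv hndiv hP' hgen' htors' hdiv' hndiv'
    q q' hq hq' ι φ Ω 𝓔 D c hΩ hφ hc himc
  obtain ⟨hm, hinj⟩ :=
    hdict K 𝔭 W' C hF hr κ hκ P n P' n' hP hgen htors hdiv hndiv hP' hgen' htors' hdiv' hndiv'
  have hS := hsat K 𝔭 W' C hF hr κ hκ (n + n') hm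
  have hl : D.HasLocalBottomIndexExpZp (c + (n + n')) :=
    hsplit K 𝔭 W' C hF hr κ hκ γ ι φ Ω 𝓔 D c hc hS hinj (n + n') hm
  have hval := hopen K 𝔭 W' C hF hr κ hκ γ P n P' n' hP hgen htors hdiv hndiv hP' hgen' htors' hdiv'
    hndiv' q q' hq hq' ι φ Ω 𝓔 D c hΩ hφ hc himc (c + (n + n')) hl
  push_cast at hval
  linarith

end RubinFormulaLineZp

/-! ## The RELATIVE saturation stub `S_sat-Zp` (reshape of `S_sat`; seat `bsd-cm-k7r-c4` g6, line owner,
on the request of seat `bsd-cm-k7r-c2` g5, STATUS 2026-08-26T22:32Z / 22:57Z) and the re-threaded composition -/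

section RubinFormulaLineZpRelative

/-- **S_sat-Zp — BOTTOM SATURATION, RELATIVE FORM (typed input; nothing asserted): `S_{p,rel}(E/K) ≤
E(K) ⊗ ℤ_p` AT THE PINNED DATUM.** The same conclusion as `RamifiedCMBottomSaturationAt` — at the bottom
layer, `relaxedCompactSelmerOver (κ.layerSubgroup 0) p {𝔭} ≤ mordellWeilKummerSpan p (κ.layerSubgroup 0)` —
but with, as binders, EVERYTHING the composition of the line `rubin-formula-zp` holds when it calls the
stub: the frame and `r_an(W) = 1`, the anticyclotomic tower `κ` with generator `γ`, the frame data
(`P`, `P'` generators modulo torsion, no `p`-torsion over `ℚ_p`, exact levels `n`, `n'`, `#Ш_an = q, q'`),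
the PINNED datum `D` (`Ω ≠ 0`, `L(φ, s) = L(W, s)` on `re s > 3/2`) with its bottom index exponent `c` over
`𝒪_𝔭 · z(𝟙)` (`D.HasBottomIndexExpZp c`) and the IMC identity, a local Mordell–Weil exponent `m`
(`HasBottomLocalMordellWeilIndexExp W p K 𝔭 κ m`) and (inj). WHY THE RESHAPE: without the exponent `c` there
is no upper bound on `S_{p,rel}` short of global (Poitou–Tate) duality, which the tree does not hold; WITH
it, `[S_{p,rel} : S_p] ∣ p^c` as soon as `z(𝟙) ∈ S_p(E/K)` and `S_p(E/K) ≤ E(K) ⊗ ℤ_p`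
(`…Theorems.RamifiedSevenEllipticUnits.RelaxedEqCompact.relaxed_le_mordellWeilKummerSpan_of_hasBottomIndexExpZp`,
seat k7r-c2 g5), so the CONTENT left is: (i) `z(𝟙) ∈ S_p(E/K)` — [BKNO] Lemma 7.1 at `χ = 𝟙` read through
the datum's reciprocity law (`BottomClass.bottom_mem_compactSelmerOver` under `hvan`: the level-`0`
central values `L(φχ, 1)` vanish, which the pin and `r_an(W) = 1` give once the level-`0` anticyclotomic
characters are shown trivial), and (ii) `S_p(E/K) ≤ E(K) ⊗ ℤ_p`, i.e. `T_pШ(E/K) = 0` (Perrin-Riou's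
descent sequence; from the finiteness of `Ш(E/ℚ)[p^∞]`, `Ш(E'/ℚ)[p^∞]` — the GZK antecedent of the
registered stub — by odd-part quadratic descent and Mordell–Weil). RELATIVE (shared `(D, c)`, like
`S_B4′`, `S_open`); fact-free as a `Prop`; the registered stub carries the published antecedent
`rank_eq_analyticRank_of_analyticRank_le_one`. [cite: PerrinRiou1987BSMF, §0 pp. 401–402 (the descent sequence `0 → E(L) ⊗ ℤ_p → S_p(L) → T_pШ → 0`)]
[cite: BurungaleKobayashiNakamuraOta2026, §3.1.2, §3.3.1 and Lemma 7.1 (arXiv:2608.06879 pp. 16, 19, 40) (claim; preprint; shape only)] -/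
@[conjecture] def RamifiedCMBottomSaturationAtZp : Prop :=
  ∀ (K : Type) [Field K] [NumberField K] (𝔭 : HeightOneSpectrum (𝓞 K))
    (W' : WeierstrassCurve ℚ) [W'.IsElliptic] [W'.IsGloballyMinimal] (C : VariableChange ℚ),
    IsFrame W p K 𝔭 W' C → W.analyticRank = 1 →
    ∀ (κ : ZpExtension K p), κ.IsAnticyclotomic →
      ∀ (γ : absoluteGaloisGroup K) [Fact (κ.IsTopGenerator γ)]
        (P : W.toAffine.Point) (n : ℕ) (P' : W'.toAffine.Point) (n' : ℕ),
        ¬ IsOfFinAddOrder P →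
        (∀ R : W.toAffine.Point, ∃ (k : ℤ) (T : W.toAffine.Point), IsOfFinAddOrder T ∧ R = k • P + T) →
        (∀ Q : (W.baseChange ℚ_[p]).toAffine.Point, p • Q = 0 → Q = 0) →
        (∃ Q : (W.baseChange ℚ_[p]).toAffine.Point, p ^ n • Q = W.toPadicPoint p P) →
        (∀ Q : (W.baseChange ℚ_[p]).toAffine.Point, p ^ (n + 1) • Q ≠ W.toPadicPoint p P) →
        ¬ IsOfFinAddOrder P' →
        (∀ R : W'.toAffine.Point, ∃ (k : ℤ) (T : W'.toAffine.Point),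
          IsOfFinAddOrder T ∧ R = k • P' + T) →
        (∀ Q : (W'.baseChange ℚ_[p]).toAffine.Point, p • Q = 0 → Q = 0) →
        (∃ Q : (W'.baseChange ℚ_[p]).toAffine.Point, p ^ n' • Q = W'.toPadicPoint p P') →
        (∀ Q : (W'.baseChange ℚ_[p]).toAffine.Point, p ^ (n' + 1) • Q ≠ W'.toPadicPoint p P') →
        ∀ (q q' : ℚ), shaAn W = (q : ℂ) → shaAn W' = (q' : ℂ) →
        ∀ (ι : PadicAlgCl p ≃+* ℂ) (φ : HeckeCharacter K) (Ω : ℂ) (𝓔 : AcDualExpSystem W p K 𝔭 κ ι)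
          (D : EllipticUnitClassData W p K 𝔭 κ γ ι φ Ω 𝓔) (c : ℕ),
          Ω ≠ 0 → (∀ s : ℂ, 3 / 2 < s.re → heckeLFunction φ s = W.LSeries s) →
          D.HasBottomIndexExpZp c →
          (∀ (n₀ : ℕ), AcSelmer.XAc.HasCharValuationAt (W.baseChange K) p κ 𝔭 ∅ γ n₀ →
            Finite {x : AcSelmer.XAc (W.baseChange K) p κ 𝔭 ∅ γ //
              (PowerSeries.X : IwasawaAlgebra p) • x = 0} →
            (n₀ : ℤ) + padicValNat p (Nat.card {x : AcSelmer.XAc (W.baseChange K) p κ 𝔭 ∅ γ //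
                (PowerSeries.X : IwasawaAlgebra p) • x = 0}) = c) →
          ∀ (m : ℕ), HasBottomLocalMordellWeilIndexExp W p K 𝔭 κ m →
            (∀ x ∈ (W.baseChange K).mordellWeilKummerSpan p (κ.layerSubgroup 0),
              (W.baseChange K).localTorsionResPi (closureEmb (K := K) (𝔭.adicCompletion K)) p
                  (κ.layerSubgroup 0) x ∈
                AddCommGroup.torsion (((W.baseChange K).baseChange (𝔭.adicCompletion K)).torsionH1Pi p
                  (localSubgroupOfEmb (κ.layerSubgroup 0) (closureEmb (K := K) (𝔭.adicCompletion K)))) →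
              x ∈ AddCommGroup.torsion ((W.baseChange K).torsionH1Pi p (κ.layerSubgroup 0))) →
            (W.baseChange K).relaxedCompactSelmerOver (κ.layerSubgroup 0) p {𝔭} ≤
              (W.baseChange K).mordellWeilKummerSpan p (κ.layerSubgroup 0)

variable {W p}

omit [W.IsGloballyMinimal] in
/-- **The intrinsic form implies the relative form** (the extra binders are simply dropped): a proof of
the original `RamifiedCMBottomSaturationAt W p` still closes the reshaped stub. [cite: PerrinRiou1987BSMF, §0 pp. 401–402 (the descent sequence)] -/
theorem ramifiedCMBottomSaturationAtZp_of_saturationAt (h : RamifiedCMBottomSaturationAt W p) :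
    RamifiedCMBottomSaturationAtZp W p := by
  intro K _ _ 𝔭 W' _ _ C hF hr κ hκ γ _ P n P' n' _ _ _ _ _ _ _ _ _ _ q q' _ _ ι φ Ω 𝓔 D c _ _ _ _ m hm _
  exact h K 𝔭 W' C hF hr κ hκ m hm

omit [W.IsGloballyMinimal] in
/-- **THE COMPOSITION OF THE REPAIRED LINE over the RELATIVE saturation stub (PROVED):
`S_dict′ → S_sat-Zp → S_B4′ → S_open → (R-PR)|IMC-Zp`.** As
`ramifiedCMBottomClassIndexLawAtZp_of_dictZp_of_sat_of_splitZp_of_rubinFormulaZp`, with `S_sat-Zp` called on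
the whole context of the value law (frame data, pinned datum, `hcZp`, IMC identity, `m_loc = n + n'`, (inj)).
The skeleton `EllipticUnitValueSevenOfGZK_of` of `Lines/rubin-formula-zp.lean` (reshape, seat k7r-c4 g6).
[cite: Miller2011LMS, Def. 1.1] -/
theorem ramifiedCMBottomClassIndexLawAtZp_of_dictZp_of_satZp_of_splitZp_of_rubinFormulaZp
    (hdict : RamifiedCMLocalMordellWeilDictAtZp W p) (hsat : RamifiedCMBottomSaturationAtZp W p)
    (hsplit : RamifiedCMBottomLocalIndexSplitAtZp W p) (hopen : RamifiedCMRubinFormulaAtZp W p) :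
    RamifiedCMBottomClassIndexLawAtZp W p := by
  intro K _ _ 𝔭 W' _ _ C hF hr κ hκ γ _ P n P' n' hP hgen htors hdiv hndiv hP' hgen' htors' hdiv' hndiv'
    q q' hq hq' ι φ Ω 𝓔 D c hΩ hφ hc himc
  obtain ⟨hm, hinj⟩ :=
    hdict K 𝔭 W' C hF hr κ hκ P n P' n' hP hgen htors hdiv hndiv hP' hgen' htors' hdiv' hndiv'
  have hS := hsat K 𝔭 W' C hF hr κ hκ γ P n P' n' hP hgen htors hdiv hndiv hP' hgen' htors' hdiv' hndiv'
    q q' hq hq' ι φ Ω 𝓔 D c hΩ hφ hc himc (n + n') hm hinj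
  have hl : D.HasLocalBottomIndexExpZp (c + (n + n')) :=
    hsplit K 𝔭 W' C hF hr κ hκ γ ι φ Ω 𝓔 D c hc hS hinj (n + n') hm
  have hval := hopen K 𝔭 W' C hF hr κ hκ γ P n P' n' hP hgen htors hdiv hndiv hP' hgen' htors' hdiv'
    hndiv' q q' hq hq' ι φ Ω 𝓔 D c hΩ hφ hc himc (c + (n + n')) hl
  push_cast at hval
  linarith

end RubinFormulaLineZpRelative

end Summit.BirchSwinnertonDyer.Rank1Residual.X12.O11

end
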